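import Summits.QuantumFields.BalabanUV.T4Continuum.Support.ShellMeasureAverageRegion
import Summits.QuantumFields.BalabanUV.T4Continuum.Support.ShellMeasureAverageAnalyticB7
import Summits.QuantumFields.BalabanUV.T4Continuum.Support.ShellMeasureAverageDerivative

/-!
# `T4Continuum.ShellMeasureAverageRegionB7` — W-d PACKAGING, THE PRINTED INSTANCE: for [B7] (15) (`𝒯 = gammaT`,
# `B12AverageCorridor267`), every binder of `ShellMeasureAverageRegion.linearizer_QtReg` is DISCHARGED by rows S49 f2
# (`ShellMeasureAverageAnalyticB7`) and S48 (`ShellMeasureAverageDerivative`) BY NAME — [B12] p. 267's linearizing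
# substitution for the printed average over ANY FINITE REGION of coarse bonds, under EXACTLY the hypotheses of
# `B12AverageCorridor267.h_paragraph_p267_gammaT` (unit-bounded background, `ε`-regular off-axis block loops, `ε ≤ 1∕8`,
# the Neumann budget `(Lᵈ∕L)·24ε < 1`)
(cell `pub-balaban`, sub-cell `t4`, spine estimate NE7c (node U5b); NE7c ROUND-2 crew seat
`b2b-balaban-t4-ne7c-formalise-leaf-07` gen 4, file 2 of the OFFER «W-d PACKAGING» (journal `CLAIMS.log`; owner table
`t4/b2b-balaban-t4-ne7c-p1/LEAVES-NE7c-P1.md` v2.1 — the owner books ∕ renumbers ∕ refuses); ADDITIVE — imports f1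
`ShellMeasureAverageRegion`, the owner's S49 f2 `ShellMeasureAverageAnalyticB7` and leaf-03's S48
`ShellMeasureAverageDerivative` ONLY; [folklore] instantiation BY NAME; 0 `def`, 0 `def … : Prop`, 0 sorry, 0 citations)

HONEST FRAMING.  Finite four-torus programme, rung (B)+1 only — NOT infinite volume, NOT a mass gap, NOT the Clay
problem, NOT summit progress; (B), `BetaPertHyp`, (B^μ) not consumed.  NE7c (`T4IndicatorShell.ShellWeightBound`) is
NOT PRINTED and NOT PROVED; «NE7c ⇐ the named binders» (trigger c3).  What is KERNEL here is a statement about the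
printed DEFINITION (2.4)∕[B7] (15) on corner cubes of `ℤᵈ` (the Literature module's typing, DIVERGENCE D-b12g20.1 — NOT
the torus, NOT (0.11)∕(0.4)) for a background `V` in the loop-level small-field regime; that the live slot's fibre of
Bałaban's renormalization step IS a fibre of this average about the step's background is the [dict] identification
(node O), NOT claimed; the plaquette ⇒ loop small field is `B12PlaquetteLoop267`'s, not used here.
HONEST DEPENDENCY: continuum YM on T⁴ ⇐ BetaPertH ∧ nine spine estimates (0/9 proved); BetaPertH ⇐ (D1) ∧ (D4) ∧ CAP+tail; G-an2-4 gates asym, D1 and NE2/3/4.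

CONTENTS (`𝒯 := fun U => gammaT L U`; `R₇ := 1 ∕ (2816·(d+1)·L)`, `b := (Lᵈ∕L) ∕ (1 − (Lᵈ∕L)·24ε)`).
* §1 the per-bond binders of f1 for the printed instance: `hQ_gammaT` (S49 f2 `Qtilde_eq_extend_restrict`),
  `hA_gammaT` (`analyticOnNhd_Qtilde_gammaT`), `hM_gammaT` (`norm_Qtilde_gammaT_le` ⇒ `≤ 1` on the ball), the fibre
  CLMs `hGenC` of S48 with `hbd_gammaT` (`h_paragraph_p267_gammaT` (iii)), and `hinv_gammaT` (S48
  `apply_res_single_hGen` in the local chart `↥(qppBonds L c) → 𝔸`, `extend_smul`, `restrict_single`).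
* §2 **`linearizer_QtReg_gammaT`** — f1's `linearizer_QtReg` with EVERY binder discharged: for finite `Λ₀`, `Λ₁` with
  `qppBonds L c ⊆ Λ₁` (`c ∈ Λ₀`), the substitution `B′ = B − hD̃(B)` of [B12] p. 267 for the region map
  `QtReg L 𝒯 V Λ₁ Λ₀` and the corridor operator `hReg hGenC`: linearizes on `closedBall 0 ρ`, unique in the `σ`-ball,
  `D̃ 0 = 0`, analytic on `ball 0 ρ` (row D4's radii `rad R₇ 1 ‖hReg‖` etc.); + `analyticOnNhd_QtReg_gammaT`,
  `norm_QtReg_gammaT_le`, `fderiv_QtReg_hReg_gammaT`, `norm_hReg_gammaT_le` for consumers.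
NOTHING in the countdown moves; NE7c NOT PROVED; spine PROVED 0/9.
-/

noncomputable section

open Set Metric Function

namespace Summit.QuantumFields.BalabanUV.T4Continuum.ShellMeasureAverageRegionB7

open Literature.MathematicalPhysics.QuantumFieldTheory.Balaban1983to89
open Literature.MathematicalPhysics.QuantumLattice (ZdEdge)
open B7BlockGeometry (qppBonds)
open B13CorridorSeparation (b0Z b0Z_mem_qppBonds)
open B12HOperator267 (gammaT)
open B12AverageCorridor267 (Qtilde loopW offAxis isBlockLocal_gammaT isAxisStraightFamily_gammaT
  h_paragraph_p267_gammaT)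
open Summit.QuantumFields.BalabanUV.Beta.LinearizingChange267 (tildeD)
open Summit.QuantumFields.BalabanUV.Beta.LinearizingChange267FromQ (nonlin rad Mq)
open ShellMeasureAverageRegion (extR resR QtReg hReg analyticOnNhd_QtReg norm_QtReg_le fderiv_QtReg_hReg norm_hReg_le
  linearizer_QtReg)
open ShellMeasureAverageAnalyticB7 (extend_restrict analyticOnNhd_Qtilde_gammaT norm_Qtilde_gammaT_le
  Qtilde_eq_extend_restrict)
open ShellMeasureAverageDerivative (hGenC hGenC_apply apply_res_single_hGen hop_bound_nonneg)

variable {d : ℕ} {𝔸 : Type*} [NormedRing 𝔸] [NormedAlgebra ℂ 𝔸] [CompleteSpace 𝔸] [NormOneClass 𝔸]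
variable {L : ℕ}

/-! ## §1 The per-bond binders of `ShellMeasureAverageRegion` for the printed instance -/

omit [CompleteSpace 𝔸] [NormOneClass 𝔸] in
/-- the extension by zero of the local chart is `ℂ`-homogeneous (S48's `hext`). [folklore] -/
theorem extend_smul {c : ZdEdge d} (s : ℂ) (B : ↥(qppBonds L c) → 𝔸) :
    Function.extend Subtype.val (s • B) (0 : ZdEdge d → 𝔸) = s • Function.extend Subtype.val B (0 : ZdEdge d → 𝔸) := by
  funext b
  by_cases hb : ∃ a : ↥(qppBonds L c), (a : ZdEdge d) = b
  · obtain ⟨a, rfl⟩ := hb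
    rw [Pi.smul_apply, Subtype.val_injective.extend_apply, Subtype.val_injective.extend_apply, Pi.smul_apply]
  · rw [Pi.smul_apply, Function.extend_apply' _ _ _ hb, Function.extend_apply' _ _ _ hb, Pi.zero_apply, smul_zero]

omit [NormedAlgebra ℂ 𝔸] [CompleteSpace 𝔸] [NormOneClass 𝔸] in
/-- restricting a one-bond field at `b₀(c)` to the local chart gives the one-bond field of the chart (S48's `res` on
`δ_{b₀(c)}`). [folklore] -/
theorem restrict_single (hL : 0 < L) (c : ZdEdge d) (X : 𝔸) :
    (fun b : ↥(qppBonds L c) => (Pi.single (b0Z L c) X : ZdEdge d → 𝔸) b) =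
      Pi.single (⟨b0Z L c, b0Z_mem_qppBonds hL c⟩ : ↥(qppBonds L c)) X := by
  funext b
  by_cases hb : b = ⟨b0Z L c, b0Z_mem_qppBonds hL c⟩
  · subst hb; simp
  · rw [Pi.single_eq_of_ne hb, Pi.single_eq_of_ne fun h => hb (Subtype.ext h)]

section Printed

variable (hL : 0 < L) (V : ZdEdge d → 𝔸ˣ) {ε : ℝ} (hε0 : 0 ≤ ε) (hε : ε ≤ 1 / 8)
  (hW : ∀ c, ∀ x ∈ offAxis L c, ‖((loopW L (fun U : ZdEdge d → 𝔸ˣ => gammaT L U) V c x : 𝔸ˣ) : 𝔸) - 1‖ ≤ ε)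
  (hV : ∀ b, ‖((V b : 𝔸ˣ) : 𝔸)‖ ≤ 1) (hV' : ∀ b, ‖(((V b)⁻¹ : 𝔸ˣ) : 𝔸)‖ ≤ 1)
  (hbud : (L : ℝ) ^ d / L * (24 * ε) < 1)

omit [NormOneClass 𝔸] in
include hL in
/-- **`hQ` for [B7] (15)**: the printed average at `c` IS the local chart map on the restriction (S49 f2
`Qtilde_eq_extend_restrict`, block locality of `gammaT`). [folklore] -/
theorem hQ_gammaT (Λ₀ : Finset (ZdEdge d)) : ∀ c ∈ Λ₀, ∀ B' : ZdEdge d → 𝔸,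
    Qtilde L (fun U : ZdEdge d → 𝔸ˣ => gammaT L U) V B' c =
      (fun (c : ZdEdge d) (B : ↥(qppBonds L c) → 𝔸) =>
        Qtilde L (fun U : ZdEdge d → 𝔸ˣ => gammaT L U) V (Function.extend Subtype.val B (0 : ZdEdge d → 𝔸)) c)
        c fun b => B' b :=
  fun _ _ B' => Qtilde_eq_extend_restrict hL (isBlockLocal_gammaT hL) V B'

include hL hV hV' hε0 hε hW in
/-- **`hA` for [B7] (15)**: per coarse bond the local chart map is analytic on `ball 0 R₇`, `R₇ = 1∕(2816(d+1)L)` (S49 f2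
`analyticOnNhd_Qtilde_gammaT`). [folklore] -/
theorem hA_gammaT (Λ₀ : Finset (ZdEdge d)) : ∀ c ∈ Λ₀,
    AnalyticOnNhd ℂ (fun B : ↥(qppBonds L c) → 𝔸 =>
      Qtilde L (fun U : ZdEdge d → 𝔸ˣ => gammaT L U) V (Function.extend Subtype.val B (0 : ZdEdge d → 𝔸)) c)
      (ball 0 (1 / (2816 * ((d : ℝ) + 1) * L))) :=
  fun c _ => analyticOnNhd_Qtilde_gammaT hL hV hV' hε0 hε (hW c)

include hL hV hV' hε0 hε hW in
/-- **`hM` for [B7] (15)**: on that ball the local chart map is bounded by `1` (S49 f2 `norm_Qtilde_gammaT_le`: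
`≤ 2816(d+1)L‖B‖ < 1`). [folklore] -/
theorem hM_gammaT (Λ₀ : Finset (ZdEdge d)) : ∀ c ∈ Λ₀, ∀ B ∈ ball (0 : ↥(qppBonds L c) → 𝔸) (1 / (2816 * ((d : ℝ) + 1) * L)),
    ‖Qtilde L (fun U : ZdEdge d → 𝔸ˣ => gammaT L U) V (Function.extend Subtype.val B (0 : ZdEdge d → 𝔸)) c‖ ≤ 1 := by
  intro c _ B hB
  rw [mem_ball_zero_iff] at hB
  have hLr : (0 : ℝ) < L := by exact_mod_cast hL
  have hK : (0 : ℝ) < 2816 * ((d : ℝ) + 1) * L := by positivity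
  refine (norm_Qtilde_gammaT_le hL hV hV' hε0 hε (hW c) hB).trans ?_
  have h1 : 2816 * ((d : ℝ) + 1) * L * ‖B‖ ≤ 2816 * ((d : ℝ) + 1) * L * (1 / (2816 * ((d : ℝ) + 1) * L)) :=
    mul_le_mul_of_nonneg_left hB.le hK.le
  rw [mul_one_div_cancel hK.ne'] at h1
  exact h1

include hε in
/-- **`hbd` for [B7] (15)**: the fibre CLMs `hGenC c` of S48 are bounded by `b = (Lᵈ∕L)∕(1 − (Lᵈ∕L)·24ε)`
(`h_paragraph_p267_gammaT` (iii)). [folklore] -/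
theorem hbd_gammaT (Λ₀ : Finset (ZdEdge d)) : ∀ c ∈ Λ₀, ∀ X : 𝔸,
    ‖hGenC hL (isBlockLocal_gammaT hL) (isAxisStraightFamily_gammaT hL) V hε0 hε hW hV hV' hbud c X‖ ≤
      ((L : ℝ) ^ d / L) / (1 - (L : ℝ) ^ d / L * (24 * ε)) * ‖X‖ :=
  fun c _ X => by
    rw [hGenC_apply]
    exact (h_paragraph_p267_gammaT hL V hε0 hε hW hV hV' hbud).2.2 c X

include hε in
/-- **`hinv` for [B7] (15)**: in the local chart the fibre map inverts the Fréchet derivative along the corridor bond,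
`DQ_c(0)·(δ_{b₀(c)}·hGenC c X) = X` — S48 `apply_res_single_hGen` with `ext := Function.extend Subtype.val · 0`,
`res := restriction`, `A := fderiv` of the analytic chart map (S49 f2). [folklore] -/
theorem hinv_gammaT (Λ₀ : Finset (ZdEdge d)) : ∀ c ∈ Λ₀, ∀ X : 𝔸,
    fderiv ℂ (fun B : ↥(qppBonds L c) → 𝔸 =>
        Qtilde L (fun U : ZdEdge d → 𝔸ˣ => gammaT L U) V (Function.extend Subtype.val B (0 : ZdEdge d → 𝔸)) c) 0
      (Pi.single (⟨b0Z L c, b0Z_mem_qppBonds hL c⟩ : ↥(qppBonds L c))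
        (hGenC hL (isBlockLocal_gammaT hL) (isAxisStraightFamily_gammaT hL) V hε0 hε hW hV hV' hbud c X)) = X := by
  intro c _ X
  have hLr : (0 : ℝ) < L := by exact_mod_cast hL
  have hR : (0 : ℝ) < 1 / (2816 * ((d : ℝ) + 1) * L) := by positivity
  have hF := ((analyticOnNhd_Qtilde_gammaT hL hV hV' hε0 hε (hW c) 0 (mem_ball_self hR)).differentiableAt).hasFDerivAt
  have h := apply_res_single_hGen (E := ↥(qppBonds L c) → 𝔸)
    (fun B : ↥(qppBonds L c) → 𝔸 => Function.extend Subtype.val B (0 : ZdEdge d → 𝔸))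
    (fun B' : ZdEdge d → 𝔸 => fun b : ↥(qppBonds L c) => B' b) (fun s v => extend_smul s v) hL
    (isBlockLocal_gammaT hL) (isAxisStraightFamily_gammaT hL) V hε0 hε hW hV hV' hbud c
    (fun B' b hb => extend_restrict B' hb) (fun _ => rfl) hF X
  rwa [restrict_single hL c, ← hGenC_apply hL (isBlockLocal_gammaT hL) (isAxisStraightFamily_gammaT hL)] at h

end Printed

/-! ## §2 [B12] p. 267's linearizing substitution for the printed average over a finite region — every binder discharged -/

section Apex

variable (hL : 0 < L) (V : ZdEdge d → 𝔸ˣ) {ε : ℝ} (hε0 : 0 ≤ ε) (hε : ε ≤ 1 / 8)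
  (hW : ∀ c, ∀ x ∈ offAxis L c, ‖((loopW L (fun U : ZdEdge d → 𝔸ˣ => gammaT L U) V c x : 𝔸ˣ) : 𝔸) - 1‖ ≤ ε)
  (hV : ∀ b, ‖((V b : 𝔸ˣ) : 𝔸)‖ ≤ 1) (hV' : ∀ b, ‖(((V b)⁻¹ : 𝔸ˣ) : 𝔸)‖ ≤ 1)
  (hbud : (L : ℝ) ^ d / L * (24 * ε) < 1)
  {Λ₁ Λ₀ : Finset (ZdEdge d)} (hcov : ∀ c ∈ Λ₀, qppBonds L c ⊆ Λ₁)

include hL hV hV' hε0 hε hW hcov in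
/-- **THE PRINTED AVERAGE OVER THE REGION IS ANALYTIC** on `ball 0 (1∕(2816(d+1)L))` (f1 `analyticOnNhd_QtReg` ∘ §1).
[folklore] -/
theorem analyticOnNhd_QtReg_gammaT :
    AnalyticOnNhd ℂ (QtReg L (fun U : ZdEdge d → 𝔸ˣ => gammaT L U) V Λ₁ Λ₀)
      (ball (0 : ↥Λ₁ → 𝔸) (1 / (2816 * ((d : ℝ) + 1) * L))) :=
  analyticOnNhd_QtReg hcov (hQ_gammaT hL V Λ₀) (hA_gammaT hL V hε0 hε hW hV hV' Λ₀)

include hL hV hV' hε0 hε hW hcov in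
/-- **… AND BOUNDED BY `1`** there (f1 `norm_QtReg_le` ∘ §1). [folklore] -/
theorem norm_QtReg_gammaT_le : ∀ B ∈ ball (0 : ↥Λ₁ → 𝔸) (1 / (2816 * ((d : ℝ) + 1) * L)),
    ‖QtReg L (fun U : ZdEdge d → 𝔸ˣ => gammaT L U) V Λ₁ Λ₀ B‖ ≤ 1 :=
  norm_QtReg_le hcov (hQ_gammaT hL V Λ₀) zero_le_one (hM_gammaT hL V hε0 hε hW hV hV' Λ₀)

include hε hcov in
/-- **THE CORRIDOR OPERATOR OF THE REGION IS BOUNDED** by `b‖D‖` (f1 `norm_hReg_le` ∘ §1). [folklore] -/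
theorem norm_hReg_gammaT_le (D : ↥Λ₀ → 𝔸) :
    ‖hReg (fun c => hGenC hL (isBlockLocal_gammaT hL) (isAxisStraightFamily_gammaT hL) V hε0 hε hW hV hV' hbud c)
        (fun c hc => hcov c hc (b0Z_mem_qppBonds hL c)) D‖ ≤
      ((L : ℝ) ^ d / L) / (1 - (L : ℝ) ^ d / L * (24 * ε)) * ‖D‖ :=
  norm_hReg_le hL _ _ (hop_bound_nonneg hL hbud) (hbd_gammaT hL V hε0 hε hW hV hV' hbud Λ₀) D

include hL hV hV' hε0 hε hW hcov in
/-- **«LQ̃h = I» FOR THE PRINTED AVERAGE OVER THE REGION**: `DQtReg(0) ∘ hReg = id` (f1 `fderiv_QtReg_hReg` ∘ §1).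
[folklore] -/
theorem fderiv_QtReg_hReg_gammaT (D : ↥Λ₀ → 𝔸) :
    fderiv ℂ (QtReg L (fun U : ZdEdge d → 𝔸ˣ => gammaT L U) V Λ₁ Λ₀) 0
      (hReg (fun c => hGenC hL (isBlockLocal_gammaT hL) (isAxisStraightFamily_gammaT hL) V hε0 hε hW hV hV' hbud c)
        (fun c hc => hcov c hc (b0Z_mem_qppBonds hL c)) D) = D := by
  have hLr : (0 : ℝ) < L := by exact_mod_cast hL
  exact fderiv_QtReg_hReg hL hcov (hQ_gammaT hL V Λ₀) (by positivity) (hA_gammaT hL V hε0 hε hW hV hV' Λ₀) _ _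
    (hinv_gammaT hL V hε0 hε hW hV hV' hbud Λ₀) D

include hL hV hV' hε0 hε hW hcov in
/-- **[B12] p. 267 FOR THE PRINTED AVERAGE [B7] (15) OVER A FINITE REGION — EVERY BINDER DISCHARGED.**  For a
unit-bounded background `V` whose off-axis block loops are `ε`-close to `1` (`0 ≤ ε ≤ 1∕8`, `(Lᵈ∕L)·24ε < 1` — the
hypotheses of `h_paragraph_p267_gammaT`), finite coarse bonds `Λ₀` and fine bonds `Λ₁ ⊇ qppBonds L c` (`c ∈ Λ₀`): with
`R₇ = 1∕(2816(d+1)L)`, `M = 1`, the corridor operator `h := hReg hGenC`, row D4's constructed radii and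
`D̃ := tildeD (nonlin QtReg) h ρ σ` — (i) `QtReg (B − h (D̃ B)) = DQtReg(0)·B` on `closedBall 0 ρ` («the transformation
B′ = B − hD̃(B) linearizes the function Q̃(B′)»), (ii) uniqueness in the `σ`-ball («exactly one solution»),
(iii) `D̃ 0 = 0`, (iv) `D̃` analytic on `ball 0 ρ` («an analytic function of B»).  A statement about the printed
DEFINITION on corner cubes of `ℤᵈ`; NOT the [dict] identification (node O); NE7c NOT PROVED. [folklore] -/
theorem linearizer_QtReg_gammaT :
    let hR := hReg (fun c => hGenC hL (isBlockLocal_gammaT hL) (isAxisStraightFamily_gammaT hL) V hε0 hε hW hV hV'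
      hbud c) (fun c hc => hcov c hc (b0Z_mem_qppBonds hL c)) (Λ₁ := Λ₁)
    let r := rad (1 / (2816 * ((d : ℝ) + 1) * L)) 1 ‖hR‖; let σ := (Real.toNNReal (4 * Mq (1 / (2816 * ((d : ℝ) + 1) * L)) 1 * r) : ℝ) * r
    let ρ := r / 4
    let Dt := tildeD (nonlin (QtReg L (fun U : ZdEdge d → 𝔸ˣ => gammaT L U) V Λ₁ Λ₀)) hR ρ σ
    (∀ B ∈ closedBall (0 : ↥Λ₁ → 𝔸) ρ,
        QtReg L (fun U : ZdEdge d → 𝔸ˣ => gammaT L U) V Λ₁ Λ₀ (B - hR (Dt B)) =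
          fderiv ℂ (QtReg L (fun U : ZdEdge d → 𝔸ˣ => gammaT L U) V Λ₁ Λ₀) 0 B) ∧
      (∀ B ∈ closedBall (0 : ↥Λ₁ → 𝔸) ρ, ∀ D ∈ closedBall (0 : ↥Λ₀ → 𝔸) σ,
        QtReg L (fun U : ZdEdge d → 𝔸ˣ => gammaT L U) V Λ₁ Λ₀ (B - hR D) =
          fderiv ℂ (QtReg L (fun U : ZdEdge d → 𝔸ˣ => gammaT L U) V Λ₁ Λ₀) 0 B → D = Dt B) ∧
      Dt 0 = 0 ∧ AnalyticOnNhd ℂ Dt (ball (0 : ↥Λ₁ → 𝔸) ρ) := by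
  have hLr : (0 : ℝ) < L := by exact_mod_cast hL
  exact linearizer_QtReg hL hcov (hQ_gammaT hL V Λ₀) (by positivity) (hA_gammaT hL V hε0 hε hW hV hV' Λ₀) zero_le_one
    (hM_gammaT hL V hε0 hε hW hV hV' Λ₀) _ _ (hinv_gammaT hL V hε0 hε hW hV hV' hbud Λ₀)

end Apex

end Summit.QuantumFields.BalabanUV.T4Continuum.ShellMeasureAverageRegionB7

end
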